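import Mathlib.Analysis.InnerProductSpace.Projection.Reflection
import Mathlib.Analysis.SpecialFunctions.Trigonometric.Basic
import Mathlib.MeasureTheory.Integral.Bochner.Basic
import Literature.Analysis.Complex.PositiveKernelContinuation
import HarnessLib

/-!
# Reflection positivity of a translation-invariant kernel with respect to a hyperplane mirror

Let `E` be a real inner product space, `n : E` a normal vector and
`θ_n = ((ℝ ∙ n)ᗮ).reflection` (Mathlib) the orthogonal reflection in the MIRROR HYPERPLANE `n^⊥`
through the origin (`θ_n x = x - (2⟪x, n⟫/‖n‖²) n`, `θ_n n = -n`, `θ_n = id` on `n^⊥`).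
A kernel `K : E → ℝ` — always thought of as the translation-invariant two-point kernel
`(x, y) ↦ K (x - y)` — is **reflection positive with respect to the mirror `n^⊥`**
(`IsMirrorRPKernel n K`) if for all finite families of points `p_a` in the OPEN positive
half-space `⟪p_a, n⟫ > 0` and all real coefficients `c_a`,

  `∑_a ∑_b c_a c_b K (p_a - θ_n p_b) ≥ 0`.

This is the Osterwalder–Schrader positivity axiom [OsterwalderSchrader1975, (E2)] for a
two-point function, in the half-space/hyperplane form of Fröhlich–Israel–Lieb–Simon
[FrohlichEtAl1978, §2 (RP: `⟨A θ(A)⟩ ≥ 0` for `A ∈ 𝔄₊`) and §3 (3.3), (3.6): a coupling `J` is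
"reflection positive" iff `∑ᵢⱼ z̄ᵢ zⱼ J(i + j - 1, i₂ - j₂, …) ≥ 0`, i.e. `∑ z̄ᵢ zⱼ J(pᵢ - θ pⱼ) ≥ 0`
over sites `pᵢ` on the positive side of the plane `x₁ = 1/2`] and of Glimm–Jaffe
[GlimmJaffeQP1987, Def. 6.2.1 (`0 ≤ ⟨θ f, C f⟩` for `f` supported at positive times) and
Def. 7.10.2 (`0 ≤ Π₊ θ C Π₊`, reflection positivity of a covariance with respect to a hyperplane
`Π`)], evaluated on finite combinations of point masses `F = ∑ c_a δ_{p_a}`.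

## Contents (everything here is proved)

* `mirrorReflection_apply` and friends: the explicit formula for `θ_n` and the identities
  `⟪θ_n x, n⟫ = -⟪x, n⟫`, `⟪p - θ_n q, n⟫ = ⟪p, n⟫ + ⟪q, n⟫`, `θ_{R n} (R x) = R (θ_n x)` for linear
  isometries `R`, `θ_{c n} = θ_n` (`c ≠ 0`).
* `IsMirrorRPKernel n K`: the predicate, literally in the form inlined in route
  `CriticalPhenomena/Ising3DConformalLimit/HyperoctahedralRP` (items `HRP2Rigidity`,
  `TwoPointKernelOfLimit`), with `Fintype`- and `Finset`-indexed forms of the inequality.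
* Structure: only the values of `K` on the open half-space `{x | 0 < ⟪x, n⟫}` matter
  (`IsMirrorRPKernel.congr`); the RP kernels form a pointwise-closed convex cone
  (`zero`, `const`, `add`, `const_mul`, `sum`, `integral` = nonnegative mixtures, `of_tendsto` =
  stability under pointwise limits on the half-space — the mechanism by which lattice reflection
  positivity passes to scaling limits, cf. [GlimmJaffeQP1987, §10.4 Remark after Thm. 10.4.3:
  "reflection positivity is preserved under limits"]); invariance under dilations
  (`comp_smul`), under translation by nonnegative multiples of the normal (`comp_add_smul` — the
  semigroup structure `t ↦ K (· + t n)`), under rescaling / negating the normal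
  (`smul_normal_iff`, `neg_normal_iff`) and transport under linear isometries
  (`comp_linearIsometryEquiv_iff`); the diagonal consequence `0 ≤ K (t • n)` for `t > 0`.
* The Gram (finite-rank feature map) criterion `of_sum_mul` / `of_inner` — the easy direction of
  the OS reconstruction — and with it the basic examples: `exp (-r ⟪x, n⟫) cos ⟪x, q⟫` for
  `q ⊥ n` (the extremal kernels of the Laplace–Fourier representation of positive-definite
  functions on the half-space semigroup `(0, ∞) × n^⊥`, [BergChristensenRessel1984, §4.4]) is
  mirror-RP for every `r : ℝ`; the Gaussian `exp (-t ‖x‖²)`, `t > 0`, is NOT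
  (`not_isMirrorRPKernel_gaussian`: the `2 × 2` configuration `p = n, 2n` already fails).
* The bridge to the tree's complex positive-semidefinite kernels
  `Literature.Analysis.Complex.IsPosSemidefKernelOn`: mirror-RP of `K` is implied by, and for
  kernels symmetric on the half-space (`K (p - θ q) = K (q - θ p)`, e.g. `K` even and
  `θ_n`-invariant) equivalent to, positive-semidefiniteness of `(p, q) ↦ K (p - θ_n q)` on the open
  half-space (`of_isPosSemidefKernelOn`, `isPosSemidefKernelOn`), which makes the limit /
  analytic-continuation API of that file available.

## Conventions and what is NOT here

* The printed lattice/continuum condition for the two-point function `(x, y) ↦ K (x - y)` reads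
  `∑ c_a c_b K (θ p_a - p_b) ≥ 0`; this is `IsMirrorRPKernel n (fun x => K (-x))`
  (`isMirrorRPKernel_neg_arg_iff`), and coincides with `IsMirrorRPKernel n K` for even kernels
  (two-point functions of a scalar field are even) and for `θ_n`-invariant kernels.
* `n = 0` is a junk case: the open half-space is empty and every kernel is RP
  (`of_normal_eq_zero`).
* NOT here (future named facts / theorems): the converse representation theorem "mirror-RP +
  continuity (+ boundedness) ⇒ `K (t n̂ + y) = ∫ e^{-λ t} e^{i q·y} dν(λ, q)`"
  ([BergChristensenRessel1984, Thm. 4.2.8, §4.4]; Widder–Bernstein for `y = 0`), and the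
  reflection positivity of the free propagators / Riesz kernels `‖x‖^{-2Δ}`, `Δ ≥ (d-2)/2`
  ([GlimmJaffeQP1987, Prop. 6.2.5, Thm. 7.10.1]; in the tree as the named facts
  `Literature.MathematicalPhysics.QuantumLattice.freeCovariance_reflectionPositive`,
  `…freeCovarianceMassless_reflectionPositive` in smeared form).

## Mathlib

Mathlib has `Submodule.reflection`, `Matrix.PosSemidef` and positive-definite matrices, but no
notion of reflection positivity or of positive-definite functions on semigroups (searched:
`reflection positiv`, `ReflectionPositive`, `PosSemidef`, `positive definite function`).
-/

noncomputable section

open Finset Filter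
open scoped BigOperators InnerProductSpace Topology ComplexConjugate ComplexOrder

namespace Literature.MathematicalPhysics.QuantumFieldTheory

variable {E : Type*} [NormedAddCommGroup E] [InnerProductSpace ℝ E]
variable {E' : Type*} [NormedAddCommGroup E'] [InnerProductSpace ℝ E']

/-! ### The reflection in the mirror hyperplane `n^⊥` -/

/-- The reflection in the hyperplane `(ℝ ∙ n)ᗮ` is `x ↦ x - (2⟪x, n⟫/‖n‖²) n` (for `n = 0` both
sides are `x`, with Mathlib's `r / 0 = 0`). [folklore] -/
theorem mirrorReflection_apply (n x : E) :
    (ℝ ∙ n)ᗮ.reflection x = x - (2 * ⟪x, n⟫_ℝ / ‖n‖ ^ 2) • n := by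
  rw [Submodule.reflection_orthogonal_apply, Submodule.reflection_singleton_apply,
    real_inner_comm x n]
  simp only [RCLike.ofReal_real_eq_id, id_eq, neg_sub, two_nsmul, ← add_smul]
  congr 1
  ring

/-- The mirror reflection negates the normal: `θ_n n = -n`. [folklore] -/
theorem mirrorReflection_normal (n : E) : (ℝ ∙ n)ᗮ.reflection n = -n :=
  Submodule.reflection_orthogonalComplement_singleton_eq_neg n

/-- The mirror reflection fixes the mirror: `θ_n q = q` for `⟪q, n⟫ = 0`. [folklore] -/
theorem mirrorReflection_of_inner_eq_zero {n q : E} (hq : ⟪q, n⟫_ℝ = 0) :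
    (ℝ ∙ n)ᗮ.reflection q = q :=
  Submodule.reflection_mem_subspace_eq_self
    (Submodule.mem_orthogonal_singleton_iff_inner_left.2 hq)

/-- `⟪θ_n x, n⟫ = -⟪x, n⟫`: the reflection flips the normal component. [folklore] -/
theorem inner_mirrorReflection_normal (n x : E) :
    ⟪(ℝ ∙ n)ᗮ.reflection x, n⟫_ℝ = -⟪x, n⟫_ℝ := by
  rw [mirrorReflection_apply, inner_sub_left, real_inner_smul_left, real_inner_self_eq_norm_sq]
  by_cases hn : n = 0
  · simp [hn]
  · have : ‖n‖ ≠ 0 := norm_ne_zero_iff.2 hn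
    field_simp
    ring

/-- The normal component of `p - θ_n q` is the SUM of the normal components:
`⟪p - θ_n q, n⟫ = ⟪p, n⟫ + ⟪q, n⟫`. [folklore] -/
theorem inner_sub_mirrorReflection_normal (n p q : E) :
    ⟪p - (ℝ ∙ n)ᗮ.reflection q, n⟫_ℝ = ⟪p, n⟫_ℝ + ⟪q, n⟫_ℝ := by
  rw [inner_sub_left, inner_mirrorReflection_normal, sub_neg_eq_add]

/-- In particular `p - θ_n q` lies in the open positive half-space when `p` and `q` do.
[folklore] -/
theorem inner_sub_mirrorReflection_normal_pos {n p q : E} (hp : 0 < ⟪p, n⟫_ℝ)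
    (hq : 0 < ⟪q, n⟫_ℝ) : 0 < ⟪p - (ℝ ∙ n)ᗮ.reflection q, n⟫_ℝ := by
  rw [inner_sub_mirrorReflection_normal]; exact add_pos hp hq

/-- The mirror component is preserved: `⟪θ_n x, q⟫ = ⟪x, q⟫` for `q ⊥ n`. [folklore] -/
theorem inner_mirrorReflection_of_inner_eq_zero {n q : E} (hq : ⟪q, n⟫_ℝ = 0) (x : E) :
    ⟪(ℝ ∙ n)ᗮ.reflection x, q⟫_ℝ = ⟪x, q⟫_ℝ := by
  conv_lhs => rw [← mirrorReflection_of_inner_eq_zero hq]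
  rw [LinearIsometryEquiv.inner_map_map]

/-- Mirror reflections are transported by linear isometries: `θ_{R n} (R x) = R (θ_n x)`.
[folklore] -/
theorem mirrorReflection_map_apply (R : E ≃ₗᵢ[ℝ] E') (n x : E) :
    (ℝ ∙ R n)ᗮ.reflection (R x) = R ((ℝ ∙ n)ᗮ.reflection x) := by
  rw [mirrorReflection_apply, mirrorReflection_apply, LinearIsometryEquiv.inner_map_map,
    LinearIsometryEquiv.norm_map, map_sub, LinearIsometryEquiv.map_smul]

/-- Rescaling the normal does not change the mirror reflection. [folklore] -/
theorem mirrorReflection_smul_normal {c : ℝ} (hc : c ≠ 0) (n x : E) :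
    (ℝ ∙ (c • n))ᗮ.reflection x = (ℝ ∙ n)ᗮ.reflection x := by
  rw [mirrorReflection_apply, mirrorReflection_apply, real_inner_smul_right, norm_smul,
    smul_smul, Real.norm_eq_abs, mul_pow, sq_abs]
  by_cases hn : n = 0
  · simp [hn]
  · congr 1
    have : ‖n‖ ≠ 0 := norm_ne_zero_iff.2 hn
    field_simp

/-- Negating the normal does not change the mirror reflection. [folklore] -/
theorem mirrorReflection_neg_normal (n x : E) :
    (ℝ ∙ (-n))ᗮ.reflection x = (ℝ ∙ n)ᗮ.reflection x := by
  rw [show -n = (-1 : ℝ) • n by simp, mirrorReflection_smul_normal (by norm_num)]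

/-! ### The predicate -/

/-- **Reflection positivity of a translation-invariant kernel with respect to the hyperplane
mirror `n^⊥`.** For a real inner product space `E`, a normal vector `n` and `K : E → ℝ`
(the two-point kernel `(x, y) ↦ K (x - y)`): for every finite family of points `p_a` in the
OPEN positive half-space `⟪p_a, n⟫ > 0` and real coefficients `c_a`,
`0 ≤ ∑_a ∑_b c_a c_b K (p_a - θ_n p_b)`, where `θ_n = ((ℝ ∙ n)ᗮ).reflection` is the reflection
in the mirror hyperplane; i.e. `⟨θ F, F⟩ ≥ 0` for `F = ∑ c_a δ_{p_a}` supported at positive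
`n`-"times". Osterwalder–Schrader positivity (E2) for two-point functions in the hyperplane
form of Fröhlich–Israel–Lieb–Simon (their (3.3)/(3.6) is the lattice case `n = e₁`, mirror
`x₁ = 1/2`, in exactly this `K (p_a - θ p_b)` form) and Glimm–Jaffe (Def. 6.2.1, Def. 7.10.2,
point masses instead of test functions). Only the values of `K` on the open half-space enter
(`IsMirrorRPKernel.congr`); `n = 0` is a junk case (everything is RP). For the printed variant
`K (θ p_a - p_b)` see `isMirrorRPKernel_neg_arg_iff`.
[cite: FrohlichEtAl1978, §2 Definition (RP) and §3 (3.3), (3.6)]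
[cite: GlimmJaffeQP1987, Def. 6.2.1 and Def. 7.10.2] -/
def IsMirrorRPKernel (n : E) (K : E → ℝ) : Prop :=
  ∀ (m : ℕ) (p : Fin m → E) (c : Fin m → ℝ), (∀ a, 0 < inner ℝ (p a) n) →
    0 ≤ ∑ a, ∑ b, c a * c b * K (p a - ((ℝ ∙ n)ᗮ).reflection (p b))

/-- The printed form of hyperplane reflection positivity for the two-point function
`(x, y) ↦ K (x - y)`, `0 ≤ ∑ c_a c_b K (θ_n p_a - p_b)` (Fröhlich–Israel–Lieb–Simon `⟨θ(F) F⟩ ≥ 0`,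
Glimm–Jaffe `0 ≤ Π₊ θ C Π₊` on point masses), is `IsMirrorRPKernel n (K ∘ Neg.neg)`; for even `K`
the two agree. [cite: GlimmJaffeQP1987, Def. 7.10.2] -/
theorem isMirrorRPKernel_neg_arg_iff (n : E) (K : E → ℝ) :
    IsMirrorRPKernel n (fun x => K (-x)) ↔
      ∀ (m : ℕ) (p : Fin m → E) (c : Fin m → ℝ), (∀ a, 0 < ⟪p a, n⟫_ℝ) →
        0 ≤ ∑ a, ∑ b, c a * c b * K ((ℝ ∙ n)ᗮ.reflection (p a) - p b) := by
  refine forall₄_congr fun m p c _ => ?_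
  rw [Finset.sum_comm]
  simp only [neg_sub, mul_comm (c _) (c _)]

namespace IsMirrorRPKernel

variable {n : E} {K K₁ K₂ : E → ℝ}

/-- The defining inequality for families indexed by an arbitrary finite type. [folklore] -/
theorem sum_nonneg {ι : Type*} [Fintype ι] (h : IsMirrorRPKernel n K) (p : ι → E) (c : ι → ℝ)
    (hp : ∀ i, 0 < ⟪p i, n⟫_ℝ) :
    0 ≤ ∑ i, ∑ j, c i * c j * K (p i - (ℝ ∙ n)ᗮ.reflection (p j)) := by
  classical
  set e := (Fintype.equivFin ι).symm with he
  have h' := h (Fintype.card ι) (p ∘ e) (c ∘ e) fun a => hp _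
  simp only [Function.comp_apply] at h'
  have h1 : ∑ i, ∑ j, c (e i) * c (e j) * K (p (e i) - (ℝ ∙ n)ᗮ.reflection (p (e j))) =
      ∑ i, ∑ j, c i * c j * K (p i - (ℝ ∙ n)ᗮ.reflection (p j)) := by
    rw [e.sum_comp (fun i => ∑ j, c i * c (e j) * K (p i - (ℝ ∙ n)ᗮ.reflection (p (e j))))]
    exact Finset.sum_congr rfl fun i _ =>
      e.sum_comp (fun j => c i * c j * K (p i - (ℝ ∙ n)ᗮ.reflection (p j)))
  rwa [h1] at h'

/-- The defining inequality for families indexed by a `Finset`, with the half-space condition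
only on the `Finset`. [folklore] -/
theorem finset_sum_nonneg {ι : Type*} (h : IsMirrorRPKernel n K) (s : Finset ι) (p : ι → E)
    (c : ι → ℝ) (hp : ∀ i ∈ s, 0 < ⟪p i, n⟫_ℝ) :
    0 ≤ ∑ i ∈ s, ∑ j ∈ s, c i * c j * K (p i - (ℝ ∙ n)ᗮ.reflection (p j)) := by
  have key : ∑ i ∈ s, ∑ j ∈ s, c i * c j * K (p i - (ℝ ∙ n)ᗮ.reflection (p j)) =
      ∑ i : s, ∑ j : s, c i * c j * K (p i - (ℝ ∙ n)ᗮ.reflection (p j)) := by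
    rw [← Finset.sum_coe_sort s]
    exact Finset.sum_congr rfl fun i _ => (Finset.sum_coe_sort s _).symm
  rw [key]
  exact h.sum_nonneg (fun i : s => p i) (fun i => c i) fun i => hp i i.2

/-- Only the values of `K` on the open positive half-space `{x | 0 < ⟪x, n⟫}` matter (the
arguments `p_a - θ_n p_b` all lie there). [folklore] -/
theorem congr (h : IsMirrorRPKernel n K₁) (hK : ∀ x, 0 < ⟪x, n⟫_ℝ → K₁ x = K₂ x) :
    IsMirrorRPKernel n K₂ := by
  intro m p c hp
  have := h m p c hp
  simpa only [hK _ (inner_sub_mirrorReflection_normal_pos (hp _) (hp _))] using this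

/-- Junk case: for the zero normal the open half-space is empty and every kernel is RP.
[folklore] -/
theorem of_normal_eq_zero (K : E → ℝ) : IsMirrorRPKernel (0 : E) K := by
  rintro (_ | m) p c hp
  · simp
  · exact absurd (hp 0) (by simp)

/-! ### The RP kernels form a pointwise-closed convex cone -/

/-- The zero kernel is RP. [folklore] -/
theorem zero : IsMirrorRPKernel n (fun _ => 0) := fun m p c _ => by simp

/-- Nonnegative constants are RP (`∑ c_a c_b C = C (∑ c_a)²`). [folklore] -/
theorem const {C : ℝ} (hC : 0 ≤ C) : IsMirrorRPKernel n (fun _ => C) := by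
  intro m p c _
  have h : ∑ a, ∑ b, c a * c b * C = (∑ a, c a) * (∑ a, c a) * C := by
    rw [Finset.sum_mul_sum, Finset.sum_mul]
    exact Finset.sum_congr rfl fun a _ => by rw [Finset.sum_mul]
  rw [h]
  exact mul_nonneg (mul_self_nonneg _) hC

/-- Sums of RP kernels are RP. [folklore] -/
theorem add (h₁ : IsMirrorRPKernel n K₁) (h₂ : IsMirrorRPKernel n K₂) :
    IsMirrorRPKernel n (fun x => K₁ x + K₂ x) := by
  intro m p c hp
  have := add_nonneg (h₁ m p c hp) (h₂ m p c hp)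
  simpa only [mul_add, Finset.sum_add_distrib] using this

/-- Nonnegative multiples of RP kernels are RP. [folklore] -/
theorem const_mul (h : IsMirrorRPKernel n K) {r : ℝ} (hr : 0 ≤ r) :
    IsMirrorRPKernel n (fun x => r * K x) := by
  intro m p c hp
  have key : ∑ a, ∑ b, c a * c b * (r * K (p a - (ℝ ∙ n)ᗮ.reflection (p b))) =
      r * ∑ a, ∑ b, c a * c b * K (p a - (ℝ ∙ n)ᗮ.reflection (p b)) := by
    rw [Finset.mul_sum]
    refine Finset.sum_congr rfl fun a _ => ?_
    rw [Finset.mul_sum]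
    exact Finset.sum_congr rfl fun b _ => by ring
  rw [key]
  exact mul_nonneg hr (h m p c hp)

/-- Finite sums of RP kernels are RP. [folklore] -/
theorem sum {ι : Type*} (s : Finset ι) {K : ι → E → ℝ} (h : ∀ i ∈ s, IsMirrorRPKernel n (K i)) :
    IsMirrorRPKernel n (fun x => ∑ i ∈ s, K i x) := by
  classical
  induction s using Finset.induction_on with
  | empty => simpa using (zero : IsMirrorRPKernel n fun _ => 0)
  | @insert i s hi ih =>
    have := (h i (Finset.mem_insert_self _ _)).add (ih fun j hj => h j (Finset.mem_insert_of_mem hj))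
    simpa only [Finset.sum_insert hi] using this

/-- **Nonnegative mixtures of RP kernels are RP**: if `K ω` is RP for a.e. `ω` and
`ω ↦ K ω x` is integrable for each `x`, then `x ↦ ∫ K ω x dμ(ω)` is RP. [folklore] -/
theorem integral {Ω : Type*} [MeasurableSpace Ω] {μ : MeasureTheory.Measure Ω} {K : Ω → E → ℝ}
    (h : ∀ᵐ ω ∂μ, IsMirrorRPKernel n (K ω))
    (hint : ∀ x, 0 < ⟪x, n⟫_ℝ → MeasureTheory.Integrable (fun ω => K ω x) μ) :
    IsMirrorRPKernel n (fun x => ∫ ω, K ω x ∂μ) := by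
  intro m p c hp
  have hint' : ∀ a b, MeasureTheory.Integrable
      (fun ω => c a * c b * K ω (p a - (ℝ ∙ n)ᗮ.reflection (p b))) μ := fun a b =>
    (hint _ (inner_sub_mirrorReflection_normal_pos (hp a) (hp b))).const_mul _
  have key : ∑ a, ∑ b, c a * c b * ∫ ω, K ω (p a - (ℝ ∙ n)ᗮ.reflection (p b)) ∂μ =
      ∫ ω, ∑ a, ∑ b, c a * c b * K ω (p a - (ℝ ∙ n)ᗮ.reflection (p b)) ∂μ := by
    rw [MeasureTheory.integral_finsetSum _ fun a _ =>
      MeasureTheory.integrable_finsetSum _ fun b _ => hint' a b]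
    refine Finset.sum_congr rfl fun a _ => ?_
    rw [MeasureTheory.integral_finsetSum _ fun b _ => hint' a b]
    exact Finset.sum_congr rfl fun b _ => (MeasureTheory.integral_const_mul _ _).symm
  rw [key]
  exact MeasureTheory.integral_nonneg_of_ae (h.mono fun ω hω => hω m p c hp)

/-- **RP is closed under pointwise limits** (on the open half-space, along any non-trivial
filter; only eventual RP of the approximants is needed) — the mechanism by which lattice
reflection positivity passes to scaling limits.
[cite: GlimmJaffeQP1987, §10.4, Remark after Thm. 10.4.3] -/
theorem of_tendsto {ι : Type*} {l : Filter ι} [l.NeBot] {Ks : ι → E → ℝ}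
    (h : ∀ᶠ i in l, IsMirrorRPKernel n (Ks i))
    (hlim : ∀ x, 0 < ⟪x, n⟫_ℝ → Tendsto (fun i => Ks i x) l (𝓝 (K x))) :
    IsMirrorRPKernel n K := by
  intro m p c hp
  have ht : Tendsto (fun i => ∑ a, ∑ b, c a * c b * Ks i (p a - (ℝ ∙ n)ᗮ.reflection (p b))) l
      (𝓝 (∑ a, ∑ b, c a * c b * K (p a - (ℝ ∙ n)ᗮ.reflection (p b)))) :=
    tendsto_finsetSum _ fun a _ => tendsto_finsetSum _ fun b _ =>
      ((hlim _ (inner_sub_mirrorReflection_normal_pos (hp a) (hp b))).const_mul _)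
  exact ge_of_tendsto ht (h.mono fun i hi => hi m p c hp)

/-! ### Symmetries -/

/-- RP is invariant under dilations `K ↦ K (s • ·)`, `s > 0` (the half-space is a cone and
`θ_n` is linear). [folklore] -/
theorem comp_smul (h : IsMirrorRPKernel n K) {s : ℝ} (hs : 0 < s) :
    IsMirrorRPKernel n (fun x => K (s • x)) := by
  intro m p c hp
  have := h m (fun a => s • p a) c fun a => by
    rw [real_inner_smul_left]; exact mul_pos hs (hp a)
  simpa only [LinearIsometryEquiv.map_smul, smul_sub] using this

/-- **Semigroup property**: if `K` is RP then so is `K (· + t • n)` for every `t ≥ 0` (shift all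
points by `(t/2) • n`, which stays in the half-space). [folklore] -/
theorem comp_add_smul (h : IsMirrorRPKernel n K) {t : ℝ} (ht : 0 ≤ t) :
    IsMirrorRPKernel n (fun x => K (x + t • n)) := by
  intro m p c hp
  have hp' : ∀ a, 0 < ⟪p a + (t / 2) • n, n⟫_ℝ := fun a => by
    rw [inner_add_left, real_inner_smul_left, real_inner_self_eq_norm_sq]
    exact add_pos_of_pos_of_nonneg (hp a) (by positivity)
  have := h m (fun a => p a + (t / 2) • n) c hp'
  have key : ∀ a b, p a + (t / 2) • n - (ℝ ∙ n)ᗮ.reflection (p b + (t / 2) • n) =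
      p a - (ℝ ∙ n)ᗮ.reflection (p b) + t • n := by
    intro a b
    rw [map_add, LinearIsometryEquiv.map_smul, mirrorReflection_normal]
    module
  simpa only [key] using this

/-- Rescaling the normal by `c > 0` changes neither the half-space nor the mirror. [folklore] -/
theorem smul_normal_iff {c : ℝ} (hc : 0 < c) :
    IsMirrorRPKernel (c • n) K ↔ IsMirrorRPKernel n K := by
  simp only [IsMirrorRPKernel, mirrorReflection_smul_normal hc.ne', real_inner_smul_right,
    mul_pos_iff_of_pos_left hc]

/-- **Negating the normal** swaps the two half-spaces: `K` is RP w.r.t. `-n` iff `K ∘ θ_n` is RP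
w.r.t. `n`. [folklore] -/
theorem neg_normal_iff :
    IsMirrorRPKernel (-n) K ↔ IsMirrorRPKernel n (fun x => K ((ℝ ∙ n)ᗮ.reflection x)) := by
  constructor
  · intro h m p c hp
    have := h m (fun a => (ℝ ∙ n)ᗮ.reflection (p a)) c fun a => by
      rw [inner_neg_right, inner_mirrorReflection_normal, neg_neg]; exact hp a
    simpa only [mirrorReflection_neg_normal, Submodule.reflection_reflection, map_sub]
      using this
  · intro h m p c hp
    have := h m (fun a => (ℝ ∙ n)ᗮ.reflection (p a)) c fun a => by
      rw [inner_mirrorReflection_normal]; simpa only [inner_neg_right] using hp a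
    simpa only [mirrorReflection_neg_normal, Submodule.reflection_reflection, map_sub]
      using this

/-- For a `θ_n`-invariant kernel, RP w.r.t. `-n` and w.r.t. `n` are the same. [folklore] -/
theorem neg_normal_iff_of_invariant (hK : ∀ x, K ((ℝ ∙ n)ᗮ.reflection x) = K x) :
    IsMirrorRPKernel (-n) K ↔ IsMirrorRPKernel n K := by
  rw [neg_normal_iff]
  simp only [hK]

/-- **Transport under linear isometries**: `K` is RP w.r.t. `R n` iff `K ∘ R` is RP w.r.t. `n`.
[folklore] -/
theorem comp_linearIsometryEquiv (R : E ≃ₗᵢ[ℝ] E') {n : E} {K : E' → ℝ}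
    (h : IsMirrorRPKernel (R n) K) : IsMirrorRPKernel n (fun x => K (R x)) := by
  intro m p c hp
  have := h m (fun a => R (p a)) c fun a => by
    rw [LinearIsometryEquiv.inner_map_map]; exact hp a
  simpa only [mirrorReflection_map_apply, ← map_sub] using this

/-- **Transport under linear isometries**, iff form: `K` is RP w.r.t. `R n` iff `K ∘ R` is RP
w.r.t. `n`. [folklore] -/
theorem comp_linearIsometryEquiv_iff (R : E ≃ₗᵢ[ℝ] E') {n : E} {K : E' → ℝ} :
    IsMirrorRPKernel (R n) K ↔ IsMirrorRPKernel n (fun x => K (R x)) := by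
  refine ⟨comp_linearIsometryEquiv R, fun h => ?_⟩
  have h' : IsMirrorRPKernel (R.symm (R n)) (fun x => K (R x)) := by rwa [R.symm_apply_apply]
  simpa only [LinearIsometryEquiv.apply_symm_apply] using comp_linearIsometryEquiv R.symm h'

/-- In particular RP w.r.t. `n` is invariant under isometries fixing `n` applied to the kernel,
and an `R`-invariant kernel is RP w.r.t. `R n` iff it is RP w.r.t. `n`. [folklore] -/
theorem map_normal_iff_of_invariant (R : E ≃ₗᵢ[ℝ] E) (hK : ∀ x, K (R x) = K x) :
    IsMirrorRPKernel (R n) K ↔ IsMirrorRPKernel n K := by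
  rw [comp_linearIsometryEquiv_iff]
  simp only [hK]

/-! ### Consequences and criteria -/

/-- Diagonal positivity (`m = 1`, `p = (t/2) n`): an RP kernel is nonnegative on the open
positive normal ray, `0 ≤ K (t • n)` for `t > 0`. [folklore] -/
theorem apply_smul_normal_nonneg (h : IsMirrorRPKernel n K) (hn : n ≠ 0) {t : ℝ} (ht : 0 < t) :
    0 ≤ K (t • n) := by
  have hp : 0 < ⟪(t / 2) • n, n⟫_ℝ := by
    rw [real_inner_smul_left, real_inner_self_eq_norm_sq]
    exact mul_pos (by linarith) (pow_pos (norm_pos_iff.2 hn) 2)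
  have := h 1 (fun _ => (t / 2) • n) (fun _ => 1) fun _ => hp
  simp only [Fin.sum_univ_one, one_mul, LinearIsometryEquiv.map_smul,
    mirrorReflection_normal] at this
  convert this using 2
  module

/-- **Gram / finite-rank feature-map criterion** (the easy direction of OS reconstruction): if on
the open half-space `K (p - θ_n q) = ∑ᵢ fᵢ p · fᵢ q` for finitely many real functions `fᵢ`, then
`K` is RP: `∑ c_a c_b K (p_a - θ p_b) = ∑ᵢ (∑_a c_a fᵢ p_a)² ≥ 0`. [folklore] -/
theorem of_sum_mul {ι : Type*} [Fintype ι] (f : ι → E → ℝ)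
    (hK : ∀ p q, 0 < ⟪p, n⟫_ℝ → 0 < ⟪q, n⟫_ℝ →
      K (p - (ℝ ∙ n)ᗮ.reflection q) = ∑ i, f i p * f i q) :
    IsMirrorRPKernel n K := by
  intro m p c hp
  have key : ∑ a, ∑ b, c a * c b * K (p a - (ℝ ∙ n)ᗮ.reflection (p b)) =
      ∑ i, (∑ a, c a * f i (p a)) * (∑ a, c a * f i (p a)) := by
    have h1 : ∀ i, (∑ a, c a * f i (p a)) * (∑ a, c a * f i (p a)) =
        ∑ a, ∑ b, c a * f i (p a) * (c b * f i (p b)) := fun i => Finset.sum_mul_sum _ _ _ _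
    simp only [h1]
    conv_rhs => rw [Finset.sum_comm]
    refine Finset.sum_congr rfl fun a _ => ?_
    conv_rhs => rw [Finset.sum_comm]
    refine Finset.sum_congr rfl fun b _ => ?_
    rw [hK _ _ (hp a) (hp b), Finset.mul_sum]
    exact Finset.sum_congr rfl fun i _ => by ring
  rw [key]
  exact Finset.sum_nonneg fun i _ => mul_self_nonneg _

/-- **Gram / feature-map criterion**, Hilbert-space form: if `K (p - θ_n q) = ⟪Φ p, Φ q⟫` on the
open half-space for some map `Φ` into a real inner product space, then `K` is RP
(`∑ c_a c_b K (p_a - θ p_b) = ‖∑ c_a Φ p_a‖² ≥ 0`). [folklore] -/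
theorem of_inner {H : Type*} [NormedAddCommGroup H] [InnerProductSpace ℝ H] (Φ : E → H)
    (hK : ∀ p q, 0 < ⟪p, n⟫_ℝ → 0 < ⟪q, n⟫_ℝ →
      K (p - (ℝ ∙ n)ᗮ.reflection q) = ⟪Φ p, Φ q⟫_ℝ) :
    IsMirrorRPKernel n K := by
  intro m p c hp
  have key : ∑ a, ∑ b, c a * c b * K (p a - (ℝ ∙ n)ᗮ.reflection (p b)) =
      ⟪∑ a, c a • Φ (p a), ∑ b, c b • Φ (p b)⟫_ℝ := by
    rw [sum_inner]
    refine Finset.sum_congr rfl fun a _ => ?_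
    rw [inner_sum]
    refine Finset.sum_congr rfl fun b _ => ?_
    rw [real_inner_smul_left, real_inner_smul_right, hK _ _ (hp a) (hp b)]
    ring
  rw [key]
  exact real_inner_self_nonneg

/-! ### Examples -/

/-- **The extremal RP kernels** `x ↦ exp (-r ⟪x, n⟫) cos ⟪x, q⟫`, `q ⊥ n`, are mirror-RP for
every `r : ℝ` (feature map `p ↦ e^{-r⟪p,n⟫} (cos ⟪p,q⟫, sin ⟪p,q⟫)`, using
`⟪p - θ q', n⟫ = ⟪p, n⟫ + ⟪q', n⟫` and `⟪θ q', q⟫ = ⟪q', q⟫`); these are the characters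
`e^{-λ t} e^{i q·y}` of the half-space semigroup in the Laplace–Fourier representation of
[BergChristensenRessel1984, §4.4]. [folklore] -/
theorem exp_mul_cos (n q : E) (hq : ⟪q, n⟫_ℝ = 0) (r : ℝ) :
    IsMirrorRPKernel n (fun x => Real.exp (-(r * ⟪x, n⟫_ℝ)) * Real.cos ⟪x, q⟫_ℝ) := by
  refine of_sum_mul
    ![fun p => Real.exp (-(r * ⟪p, n⟫_ℝ)) * Real.cos ⟪p, q⟫_ℝ,
      fun p => Real.exp (-(r * ⟪p, n⟫_ℝ)) * Real.sin ⟪p, q⟫_ℝ] fun p q' _ _ => ?_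
  rw [inner_sub_mirrorReflection_normal, inner_sub_left,
    inner_mirrorReflection_of_inner_eq_zero hq, Real.cos_sub,
    show -(r * (⟪p, n⟫_ℝ + ⟪q', n⟫_ℝ)) = -(r * ⟪p, n⟫_ℝ) + -(r * ⟪q', n⟫_ℝ) by ring, Real.exp_add]
  simp only [Fin.sum_univ_two, Matrix.cons_val_zero, Matrix.cons_val_one]
  ring

/-- **Gaussians are not reflection positive**: for `n ≠ 0` and `t > 0`, `x ↦ exp (-t ‖x‖²)` is
not mirror-RP — on the two points `n, 2n` the matrix `exp (-t (α_a + α_b)² ‖n‖²)` has negative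
determinant; with `u = t ‖n‖²` and `c = (1, -e^{7u})` the quadratic form is
`e^{-4u} - e^{-2u} < 0`. [folklore] -/
theorem _root_.Literature.MathematicalPhysics.QuantumFieldTheory.not_isMirrorRPKernel_gaussian
    {n : E} (hn : n ≠ 0) {t : ℝ} (ht : 0 < t) :
    ¬ IsMirrorRPKernel n (fun x => Real.exp (-(t * ‖x‖ ^ 2))) := by
  intro h
  set u : ℝ := t * ‖n‖ ^ 2 with hu
  have hu0 : 0 < u := mul_pos ht (pow_pos (norm_pos_iff.2 hn) 2)
  have hnn : 0 < ⟪n, n⟫_ℝ := by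
    rw [real_inner_self_eq_norm_sq]; exact pow_pos (norm_pos_iff.2 hn) 2
  have := h 2 ![n, (2 : ℝ) • n] ![1, -Real.exp (7 * u)] (fun a => by
    fin_cases a
    · simpa using hnn
    · simpa [real_inner_smul_left] using hnn)
  have key : ∀ α β : ℝ, α • n - (ℝ ∙ n)ᗮ.reflection (β • n) = (α + β) • n := by
    intro α β
    rw [LinearIsometryEquiv.map_smul, mirrorReflection_normal]
    module
  have k11 := key 1 1
  have k12 := key 1 2
  have k21 := key 2 1
  have k22 := key 2 2
  simp only [one_smul] at k11 k12 k21
  simp only [Fin.sum_univ_two, Matrix.cons_val_zero, Matrix.cons_val_one, k11, k12, k21, k22,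
    norm_smul, Real.norm_eq_abs, mul_pow, sq_abs, one_mul, mul_one, mul_neg, neg_mul,
    neg_neg] at this
  have e1 : Real.exp (-(t * ((1 + 1) ^ 2 * ‖n‖ ^ 2))) = Real.exp (-(4 * u)) := by
    congr 1; rw [hu]; ring
  have e2 : Real.exp (-(t * ((1 + 2) ^ 2 * ‖n‖ ^ 2))) = Real.exp (-(9 * u)) := by
    congr 1; rw [hu]; ring
  have e3 : Real.exp (-(t * ((2 + 1) ^ 2 * ‖n‖ ^ 2))) = Real.exp (-(9 * u)) := by
    congr 1; rw [hu]; ring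
  have e4 : Real.exp (-(t * ((2 + 2) ^ 2 * ‖n‖ ^ 2))) = Real.exp (-(16 * u)) := by
    congr 1; rw [hu]; ring
  rw [e1, e2, e3, e4] at this
  have h79 : Real.exp (7 * u) * Real.exp (-(9 * u)) = Real.exp (-(2 * u)) := by
    rw [← Real.exp_add]; congr 1; ring
  have h7716 : Real.exp (7 * u) * (Real.exp (7 * u) * Real.exp (-(16 * u))) =
      Real.exp (-(2 * u)) := by
    rw [← Real.exp_add, ← Real.exp_add]; congr 1; ring
  have hlt : Real.exp (-(4 * u)) < Real.exp (-(2 * u)) := Real.exp_lt_exp.2 (by linarith)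
  nlinarith [h79, h7716, hlt, Real.exp_pos (-(4 * u)), Real.exp_pos (-(2 * u))]

/-! ### Bridge to complex positive-semidefinite kernels -/

/-- Positive-semidefiniteness (complex coefficients, `Literature.Analysis.Complex.IsPosSemidefKernelOn`)
of `(p, q) ↦ K (p - θ_n q)` on the open half-space implies mirror-RP (take real coefficients).
[folklore] -/
theorem of_isPosSemidefKernelOn
    (h : Literature.Analysis.Complex.IsPosSemidefKernelOn
      (fun p q => ((K (p - (ℝ ∙ n)ᗮ.reflection q) : ℝ) : ℂ)) {p | 0 < ⟪p, n⟫_ℝ}) :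
    IsMirrorRPKernel n K := by
  intro m p c hp
  have h' := h m p (fun a => hp a) fun a => (c a : ℂ)
  have hsum : (∑ a, ∑ b, conj (c a : ℂ) * (c b : ℂ) *
      ((K (p a - (ℝ ∙ n)ᗮ.reflection (p b)) : ℝ) : ℂ)) =
      ((∑ a, ∑ b, c a * c b * K (p a - (ℝ ∙ n)ᗮ.reflection (p b)) : ℝ) : ℂ) := by
    push_cast
    simp only [Complex.conj_ofReal]
  rw [hsum] at h'
  exact Complex.zero_le_real.1 h'

/-- Conversely, a mirror-RP kernel which is symmetric on the half-space,
`K (p - θ q) = K (q - θ p)`, gives a positive-semidefinite complex kernel `(p, q) ↦ K (p - θ_n q)`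
on the open half-space (split `c = u + iv`: the real part is the sum of the two real quadratic
forms, the imaginary part vanishes by symmetry). [folklore] -/
theorem isPosSemidefKernelOn (h : IsMirrorRPKernel n K)
    (hsymm : ∀ p q, 0 < ⟪p, n⟫_ℝ → 0 < ⟪q, n⟫_ℝ →
      K (p - (ℝ ∙ n)ᗮ.reflection q) = K (q - (ℝ ∙ n)ᗮ.reflection p)) :
    Literature.Analysis.Complex.IsPosSemidefKernelOn
      (fun p q => ((K (p - (ℝ ∙ n)ᗮ.reflection q) : ℝ) : ℂ)) {p | 0 < ⟪p, n⟫_ℝ} := by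
  intro m p hp c
  set M : Fin m → Fin m → ℝ := fun a b => K (p a - (ℝ ∙ n)ᗮ.reflection (p b)) with hM
  have hMs : ∀ a b, M a b = M b a := fun a b => hsymm _ _ (hp a) (hp b)
  have hre : (∑ a, ∑ b, conj (c a) * c b * (M a b : ℂ)).re =
      ∑ a, ∑ b, (c a).re * (c b).re * M a b + ∑ a, ∑ b, (c a).im * (c b).im * M a b := by
    rw [Complex.re_sum, ← Finset.sum_add_distrib]
    refine Finset.sum_congr rfl fun a _ => ?_
    rw [Complex.re_sum, ← Finset.sum_add_distrib]
    refine Finset.sum_congr rfl fun b _ => ?_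
    simp only [Complex.mul_re, Complex.mul_im, Complex.conj_re, Complex.conj_im,
      Complex.ofReal_re, Complex.ofReal_im]
    ring
  have him : (∑ a, ∑ b, conj (c a) * c b * (M a b : ℂ)).im = 0 := by
    have h1 : (∑ a, ∑ b, conj (c a) * c b * (M a b : ℂ)).im =
        ∑ a, ∑ b, (c a).re * (c b).im * M a b - ∑ a, ∑ b, (c a).im * (c b).re * M a b := by
      rw [Complex.im_sum, ← Finset.sum_sub_distrib]
      refine Finset.sum_congr rfl fun a _ => ?_
      rw [Complex.im_sum, ← Finset.sum_sub_distrib]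
      refine Finset.sum_congr rfl fun b _ => ?_
      simp only [Complex.mul_re, Complex.mul_im, Complex.conj_re, Complex.conj_im,
        Complex.ofReal_re, Complex.ofReal_im]
      ring
    rw [h1, sub_eq_zero, Finset.sum_comm]
    exact Finset.sum_congr rfl fun b _ => Finset.sum_congr rfl fun a _ => by
      rw [hMs a b]; ring
  rw [Complex.nonneg_iff, hre, him]
  exact ⟨add_nonneg (h m p (fun a => (c a).re) hp) (h m p (fun a => (c a).im) hp), rfl⟩

/-- Symmetry on the half-space holds for even, `θ_n`-invariant kernels
(`q - θ p = -θ (p - θ q)`). [folklore] -/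
theorem _root_.Literature.MathematicalPhysics.QuantumFieldTheory.mirrorKernel_symm_of_even
    {n : E} {K : E → ℝ} (heven : ∀ x, K (-x) = K x)
    (hinv : ∀ x, K ((ℝ ∙ n)ᗮ.reflection x) = K x) (p q : E) :
    K (p - (ℝ ∙ n)ᗮ.reflection q) = K (q - (ℝ ∙ n)ᗮ.reflection p) := by
  rw [← hinv (p - _), map_sub, Submodule.reflection_reflection, ← heven, neg_sub]

end IsMirrorRPKernel

end Literature.MathematicalPhysics.QuantumFieldTheory
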